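import Summits.BirchSwinnertonDyer.BirchSwinnertonDyer.Theorems.QuadraticBranchSignedControlPlusEtaNonsurjKatoClauseThreeIdle
import Literature.NumberTheory.Automorphic.BCDTModularityModPProofs
import HarnessLib

/-!
# Route `QuadraticBranchSignedControl` (rung K8, cell `bsd-potss`): crux stmt-BirchSwinnertonDyer-19606
# `PlusEtaMainConjectureNonsurj` — THE CARTAN FIELD IS IMAGINARY: no involution of `Γ_ℚ` inverting `μ_p` lies in `H_V`

WHAT. FINDING-19606-k8eta-c2-g5 §2 (b): on an `X_ns⁺(p)` row the quadratic character `ε_V : Γ_ℚ → C_ns⁺/C_ns = {±1}`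
has `ε_V(c) = −1` for complex conjugation `c`, i.e. the Cartan field `K_V` is IMAGINARY — so a CM anchor needs an
imaginary quadratic CM field with `p` inert (automatic for CM, but the sign is what rules out REAL `K_V`). Kernel form,
for ANY `σ ∈ Γ_ℚ` which is an involution on `V[p]` and inverts the `p`-th roots of unity (complex conjugation is one):

* §1 `det_eq_one_of_mem_nonsplitCartan_of_mul_self_eq_one` — an INVOLUTION in `C_ns(ε)` is `±1`, so has determinant `1`
  (`M = (a, εb; b, a)`, `M² = 1` ⟹ `2ab = 0`, `a² + εb² = 1`; `a = 0` would make `ε = b⁻²` a square);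
* §2 `det_matrix_eq_neg_one_of_forall_pow_eq_inv` — if `σ` INVERTS every `p`-th root of unity then `det ρ̄_{V,p}(σ) = −1`
  (`χ_p(σ) ≡ −1 (mod p)` via a primitive `p`-th root, `det ρ_{T_pV} = χ_p` by the Weil pairing, reduction mod `p`);
* §3 **`not_centralizes_sq_of_inverts_rootsOfUnity`** — on a row (`Im ρ̄_{V,p} = C_ns⁺(p)`, `p ≠ 2`), a `σ` with `σ² = 1` on
  `V[p]` inverting `μ_p` does NOT centralise the squares: `σ ∉ H_V` — **`K_V` is not fixed by complex conjugation: it is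
  imaginary**; row-level form `…_of_row`.

HONEST FRAMING (cell `bsd-potss`, run/shared/lean/pub/bsd-potss/; FULL-BSD rank ≤ 1 programme): TOOL THEOREMS ONLY (no
definition, no named fact, no `sorry`, axioms standard); complex conjugation is not named — the statement covers every
`σ` with the two displayed properties. Nothing is booked; crux 19606 stays OPEN; `BSD(W, p)` is claimed for no pair.
Seat `bsd-potss-k8eta-c2` g9 (prover), `--supports stmt-BirchSwinnertonDyer-19606`.

References: [Serre1972] §2.2; [SilvermanAEC2009] III.8 (Weil pairing, `det ρ̄ = χ_p`); S. Frengley, arXiv:2111.05813,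
Lemma 28 (`K_V` at `p = 5`).
-/

set_option autoImplicit false
set_option linter.dupNamespace false

noncomputable section

open scoped Classical

open Matrix Field WeierstrassCurve Literature.NumberTheory.EllipticCurves Literature.NumberTheory.SerreUniformity
  Literature.NumberTheory.GaloisRepresentations

namespace Summit.BirchSwinnertonDyer.BirchSwinnertonDyer.Theorems.EtaCartanField

variable {p : ℕ} [hp : Fact p.Prime]

/-! ## §1 Involutions in the Cartan subgroup are `±1` -/

/-- **An involution in `C_ns(ε)` has determinant `1`** (`p` odd, `ε` a non-square): `M = (a, εb; b, a)` with `M² = 1`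
gives `2ab = 0` and `a² + εb² = 1`; `a = 0` is impossible (`εb² = 1` makes `ε` a square), so `b = 0`, `a² = 1`,
`det M = a² − εb² = 1`. [cite: Serre1972, §2.2] -/
theorem det_eq_one_of_mem_nonsplitCartan_of_mul_self_eq_one (hp2 : p ≠ 2) {ε : ZMod p} (hε : ¬ IsSquare ε)
    {M : Matrix (Fin 2) (Fin 2) (ZMod p)} (hM : M ∈ nonsplitCartan ε) (hMM : M * M = 1) : M.det = 1 := by
  have h2 : (2 : ZMod p) ≠ 0 := Ring.two_ne_zero (by rw [ZMod.ringChar_zmod_n]; exact hp2)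
  obtain ⟨a, b, -, rfl⟩ := hM
  rw [Matrix.mul_fin_two, Matrix.one_fin_two] at hMM
  have h00 := congrArg (fun N : Matrix (Fin 2) (Fin 2) (ZMod p) => N 0 0) hMM
  have h10 := congrArg (fun N : Matrix (Fin 2) (Fin 2) (ZMod p) => N 1 0) hMM
  simp only [Matrix.of_apply, Matrix.cons_val', Matrix.cons_val_zero, Matrix.cons_val_one,
    Matrix.cons_val_fin_one] at h00 h10
  -- `h10 : b * a + a * b = 0`, `h00 : a * a + ε * b * b = 1`
  have hab : a * b = 0 := by
    have : (2 : ZMod p) * (a * b) = 0 := by linear_combination h10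
    rcases mul_eq_zero.mp this with h | h
    · exact absurd h h2
    · exact h
  rw [Matrix.det_fin_two_of]
  rcases mul_eq_zero.mp hab with ha | hb
  · exfalso
    rw [ha] at h00
    have hb0 : b ≠ 0 := by
      intro hb; rw [hb] at h00; simp at h00
    apply hε
    refine ⟨b⁻¹, ?_⟩
    have hbb : b * b⁻¹ = 1 := mul_inv_cancel₀ hb0
    calc ε = ε * (b * b⁻¹) * (b * b⁻¹) := by rw [hbb, mul_one, mul_one]
      _ = (ε * b * b) * (b⁻¹ * b⁻¹) := by ring
      _ = b⁻¹ * b⁻¹ := by rw [show ε * b * b = 1 by linear_combination h00]; ring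
  · rw [hb] at h00 ⊢
    linear_combination h00

/-! ## §2 Inverting `μ_p` forces determinant `−1` on `V[p]` -/

section Det

variable (V : WeierstrassCurve ℚ) [V.IsElliptic]

/-- **If `σ` inverts every `p`-th root of unity then its matrix on `V[p]` has determinant `−1`**: with `ζ` a primitive
`p`-th root, `σζ = ζ^{χ_p(σ)} = ζ⁻¹` gives `χ_p(σ) ≡ −1 (mod p)`; `det ρ_{T_pV}(σ) = χ_p(σ)` (Weil pairing,
`det_galoisRepTate_eq_cyclotomicCharacter_holds`), reduction mod `p` (`det_galoisRepTorsion_eq_toZMod_det_galoisRepTate`,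
`PadicInt.cast_toZModPow_one`). [cite: SilvermanAEC2009, Prop. III.8.1 and III.8.3] [cite: SerreAbelianLadic1968, Ch. I §1.2] -/
theorem det_matrix_eq_neg_one_of_forall_pow_eq_inv (e : V.geomTorsion p ≃+ (Fin 2 → ZMod p))
    {σ : absoluteGaloisGroup ℚ} {M : Matrix (Fin 2) (Fin 2) (ZMod p)}
    (hσ : ∀ P : V.geomTorsion p, e (σ • P) = M.mulVec (e P))
    (hinv : ∀ t : AlgebraicClosure ℚ, t ^ p = 1 → σ • t = t⁻¹) : M.det = -1 := by
  letI : Module (ZMod p) (V.geomTorsion p) := AddSubgroup.torsionBy.zmodModule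
  have hprime : p.Prime := Fact.out
  have hp0 : (p : ℚ) ≠ 0 := Nat.cast_ne_zero.mpr hprime.ne_zero
  haveI : NeZero (p : ℚ) := ⟨hp0⟩
  haveI : NeZero ((p : ℕ) : AlgebraicClosure ℚ) := ⟨Nat.cast_ne_zero.mpr hprime.ne_zero⟩
  -- a primitive `p`-th root of unity and `χ_p(σ) ≡ -1 (mod p)`
  obtain ⟨ζ, hζ⟩ := HasEnoughRootsOfUnity.prim (M := AlgebraicClosure ℚ) (n := p)
  have hζp : ζ ^ p ^ 1 = 1 := by rw [pow_one]; exact hζ.pow_eq_one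
  have hspec := GaloisRep.cyclotomicCharacter_spec ℚ p (k := 1) σ ζ hζp
  set n : ℕ := (((GaloisRep.cyclotomicCharacter ℚ p σ : ℤ_[p]ˣ) : ℤ_[p]).toZModPow 1).val with hn
  rw [hinv ζ hζ.pow_eq_one] at hspec
  -- `ζ⁻¹ = ζ ^ n` ⟹ `ζ ^ (n + 1) = 1` ⟹ `p ∣ n + 1`
  have hpow : ζ ^ (n + 1) = 1 := by
    rw [pow_succ, ← hspec, inv_mul_cancel₀ (hζ.ne_zero hprime.ne_zero)]
  have hdvd : p ∣ n + 1 := (hζ.pow_eq_one_iff_dvd _).mp hpow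
  have hmod : ((n : ℕ) : ZMod p) = -1 := by
    have : (((n + 1 : ℕ) : ZMod p)) = 0 := (ZMod.natCast_eq_zero_iff _ _).mpr hdvd
    rw [Nat.cast_add, Nat.cast_one] at this
    linear_combination this
  have htoZMod : PadicInt.toZMod ((GaloisRep.cyclotomicCharacter ℚ p σ : ℤ_[p]ˣ) : ℤ_[p]) = -1 := by
    rw [← PadicInt.cast_toZModPow_one, ZMod.cast_eq_val, ← hn, hmod]
  -- `det ρ_T(σ) = χ_p(σ)`, hence `det ρ̄(σ) = -1`
  have hdetT : LinearMap.det (V.galoisRepTate p σ : V.tateModule p →ₗ[ℤ_[p]] V.tateModule p) =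
      ((GaloisRep.cyclotomicCharacter ℚ p σ : ℤ_[p]ˣ) : ℤ_[p]) :=
    V.det_galoisRepTate_eq_cyclotomicCharacter_holds p hp0 σ
  have hdetbar : LinearMap.det ((galoisRepTorsion V p σ).toAdd.toAddMonoidHom.toZModLinearMap p) = -1 := by
    rw [V.det_galoisRepTorsion_eq_toZMod_det_galoisRepTate p hp0 σ, hdetT, htoZMod]
  -- the determinant of the linear map is that of its matrix in the frame `e`
  let eL : V.geomTorsion p ≃ₗ[ZMod p] (Fin 2 → ZMod p) :=
    LinearEquiv.ofBijective (e.toAddMonoidHom.toZModLinearMap p) ⟨e.injective, e.surjective⟩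
  have heL : ∀ Q : V.geomTorsion p, eL Q = e Q := fun _ ↦ rfl
  have hconj : Matrix.toLin' M =
      eL.conj ((galoisRepTorsion V p σ).toAdd.toAddMonoidHom.toZModLinearMap p) := by
    refine LinearMap.ext fun v ↦ ?_
    obtain ⟨Q, rfl⟩ := eL.surjective v
    rw [LinearEquiv.conj_apply_apply, eL.symm_apply_apply, heL, heL, Matrix.toLin'_apply]
    change M.mulVec (e Q) = e (σ • Q)
    rw [hσ]
  rw [← LinearMap.det_toLin' M, hconj, LinearEquiv.conj_apply, LinearMap.comp_assoc, LinearMap.det_conj, hdetbar]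

end Det

/-! ## §3 The Cartan field is imaginary -/

/-- **No involution inverting `μ_p` lies in the Cartan subgroup** (`K_V` is imaginary). On a row
(`Im ρ̄_{V,p} = C_ns⁺(p)`, `p ≠ 2`), let `σ ∈ Γ_ℚ` act as an involution on `V[p]` (`σσP = P`) and invert every `p`-th
root of unity (`σt = t⁻¹`) — e.g. a complex conjugation. Then `σ` does NOT centralise the squares on `V[p]`:
`ρ̄(σ)² = 1`, and an involution in `C_ns` is `±1` of determinant `1`, while `det ρ̄(σ) = χ_p(σ) = −1`.
[cite: Serre1972, §2.2] [cite: SilvermanAEC2009, III.8] -/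
theorem not_centralizes_sq_of_inverts_rootsOfUnity (V : WeierstrassCurve ℚ) [V.IsElliptic] (hp2 : p ≠ 2)
    (h : HasModPImageEqNonsplitCartanNormalizer V p) {σ : absoluteGaloisGroup ℚ}
    (hσσ : ∀ P : V.geomTorsion p, σ • (σ • P) = P)
    (hinv : ∀ t : AlgebraicClosure ℚ, t ^ p = 1 → σ • t = t⁻¹) :
    ¬ ∀ (τ : absoluteGaloisGroup ℚ) (P : V.geomTorsion p), σ • ((τ * τ) • P) = (τ * τ) • (σ • P) := by
  obtain ⟨e, ε, hε, himg, hsurj⟩ := h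
  obtain ⟨M, hM, hMσ⟩ := himg σ
  intro hcen
  have hMC : M ∈ nonsplitCartan ε :=
    (matrix_mem_nonsplitCartan_iff_centralizes_sq hp2 e hε himg hsurj hM hMσ).mpr hcen
  -- `M * M = 1`: the matrix of `σ * σ`, which acts trivially
  have hMM : M * M = 1 := by
    have h1 : ∀ P : V.geomTorsion p, e ((σ * σ) • P) = (M * M).mulVec (e P) := matrix_mul e hMσ hMσ
    have h2 : ∀ P : V.geomTorsion p, e ((σ * σ) • P) = (1 : Matrix (Fin 2) (Fin 2) (ZMod p)).mulVec (e P) := by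
      intro P; rw [mul_smul, hσσ, Matrix.one_mulVec]
    exact matrix_unique e h1 h2
  have hdet1 := det_eq_one_of_mem_nonsplitCartan_of_mul_self_eq_one hp2 hε hMC hMM
  have hdet2 := det_matrix_eq_neg_one_of_forall_pow_eq_inv V e hMσ hinv
  rw [hdet1] at hdet2
  have h2 : (2 : ZMod p) ≠ 0 := Ring.two_ne_zero (by rw [ZMod.ringChar_zmod_n]; exact hp2)
  exact h2 (by linear_combination hdet2)

/-- **Row-level form**: on every row of crux 19606 (`V` glob. min., `p ≥ 5` good, `a_p = 0`, tower not onto) an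
involution on `V[p]` inverting `μ_p` is outside the Cartan subgroup `H_V` — the Cartan field `K_V` is imaginary.
[cite: Serre1972, §2.2] [cite: SilvermanAEC2009, III.8] -/
theorem not_centralizes_sq_of_inverts_rootsOfUnity_of_row (V : WeierstrassCurve ℚ) [V.IsElliptic]
    [V.IsGloballyMinimal] (p : ℕ) [Fact p.Prime] (hp5 : 5 ≤ p) (hgood : V.HasGoodReductionAtPrime p)
    (hap : V.frobeniusTrace p = 0) (hns : ¬ ∀ m : ℕ, V.HasSurjectiveModNGaloisRep (p ^ m : ℕ))
    {σ : absoluteGaloisGroup ℚ} (hσσ : ∀ P : V.geomTorsion p, σ • (σ • P) = P)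
    (hinv : ∀ t : AlgebraicClosure ℚ, t ^ p = 1 → σ • t = t⁻¹) :
    ¬ ∀ (τ : absoluteGaloisGroup ℚ) (P : V.geomTorsion p), σ • ((τ * τ) • P) = (τ * τ) • (σ • P) :=
  not_centralizes_sq_of_inverts_rootsOfUnity V (by omega)
    (hasModPImageEqNonsplitCartanNormalizer_of_row V p hp5 hgood hap hns) hσσ hinv

end Summit.BirchSwinnertonDyer.BirchSwinnertonDyer.Theorems.EtaCartanField

end
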